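import Summits.QuantumFields.YangMills.Theorems.BalabanUVNodesN06Row17LocalClauseOnReg335OfBall
import Literature.MathematicalPhysics.QuantumFieldTheory.Balaban1983to89.B13DirichletLocalCoerciveBall

/-!
# BalabanUVNodes ∕ N06 ([B9], `Dag.B9_main`) — ROW 17's LOCAL CLAUSE ON PRINT'S CLASS (3.35) FROM THE LOCAL-CUBE ROAD'S LETTERS: `hloc(U)` at W-a's `□̃(c)` for
# EVERY `U ∈ (bg9YP … x).Reg335 c α₀`, from station L5 of the N10 lane (dag-n10-w3 `B13DirichletLocalCoerciveBall`) composed with this seat's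
# `…LocalClauseOnReg335OfBall` — the remaining displayed inputs are L5's pencil LETTERS `hA`, the fibre count `hfib`, the centre coercivity `m_□` (`hco`),
# L5's radius inequality `hsmall` and the (3.35) radius comparison `2L⁴·Mα₀·(Lʲη)⁻¹ ≤ R′`

Track A of `YM-PLAN.md` (cell `pub-ymgap`, HUMAN RULING D-0062), node **N06** = [Balaban1985BackgroundPropagators] Thms 3.1–3.15; seat `pub-ymgap-dag-n06-j`
(bundle F5, rows 15–17), g23.  A HELPER (count-neutral, `--supports` only).

THE PRINT.  [B9] p. 416: *«Let us consider G_□(U) and let us make a gauge transformation to the gauge in which U = e^{iηA}, A small … G_□(e^{iηA}) =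
G_□(1)(I − V(A)G_□(1))⁻¹. In [4] we have proved that the operator G_□(1) is positive … Cor. 3.6»*.

WHAT.  ★★★ `posDefTr_padDeltaALocY_of_L5_of_regYP335` = `…OnReg335OfBall.posDefTr_padDeltaALocY_of_ball_of_regYP335` with its `hball` binder DISCHARGED by
dag-n10-w3's `B13DirichletLocalCoerciveBall.posDefTr_padDeltaALocY_parSymY_prodCfg_one_of_sup_lt` (station L5; shapes match verbatim): the conclusion
`PosDefTr 1 (padDeltaALocY x.toKIdx (parSymY _) (parBY _) (cubeDomY x c) (cutMulY χP) (cutMulY χ) U)` — the `hloc` input of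
`…N06Row19LocalClauseAtDirichletInverses.hGsqA_of_GAsqY_pins` at this `U` — under: print's class `(bg9YP (M_N(ℂ)) G x).Reg335 cthr α₀ U` (`cthr ≤ 10`, `α₀ ≥ 0`),
`supp χ` issuing from `□̃(c)`, L5's letters `hA : RawEntryLetters (a ↦ toMatrix (padDeltaALocY … (e^{iηa}·1))) loc R ρ B` (station L4's output), `hfib`, the centre
coercivity `hco : m·⟨Ψ,Ψ⟩₁ ≤ ⟨Ψ, padDeltaALocY … 1 Ψ⟩₁` (this seat's (a); volume-uniformity = [4] Sect. B∕C, displayed), `0 < R′ ≤ R`,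
`2·(B·(m_F·c₀(1,ρ)^ν))·R′ < m·R`, and the (3.35) comparison `2L⁴·(M·α₀)·(L^{j(c)}η)⁻¹ ≤ R′`.
HONEST FRAMING.  A two-theorem composition; nothing analytic proved here; the displayed inputs are exactly L5's + one radius inequality; Cor. 3.6 on (3.35) follows
from them at `□̃(c)` — they are NOT discharged; COUNT-NEUTRAL; N06 NOT discharged; nothing continuum ∕ OS ∕ mass gap ∕ Clay.  0 `def`, 0 `sorry`.
-/

noncomputable section

namespace Summit.QuantumFields.YangMills.BalabanUVNodes.N06Row17LocalClauseOnReg335OfL5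

open Finset
open Literature.MathematicalPhysics.QuantumFieldTheory.Balaban1983to89
open Literature.MathematicalPhysics.QuantumFieldTheory.Balaban1983to89.Node00
open Literature.MathematicalPhysics.QuantumFieldTheory.Balaban1983to89.Node00.OpsYDeltaALocal (padDeltaALocY)
open Literature.MathematicalPhysics.QuantumFieldTheory.Balaban1983to89.B6KLevelCensusIndexV1 (KIdx kGeo)
open Literature.MathematicalPhysics.QuantumFieldTheory.Balaban1983to89.B6GlobalChartV1 (PV boxEquiv)
open Literature.MathematicalPhysics.QuantumFieldTheory.Balaban1983to89.B9BackgroundsKLevelV1 (CfgV1)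
open Literature.MathematicalPhysics.QuantumFieldTheory.Balaban1983to89.B9BackgroundsKLevelV1P (bg9YP)
open Literature.MathematicalPhysics.QuantumFieldTheory.Balaban1983to89.B9PinMembersKLevelV1 (MemberY)
open Literature.MathematicalPhysics.QuantumFieldTheory.Balaban1983to89.B6Cover236MultiLevelBlocks (cubes)
open Literature.MathematicalPhysics.QuantumFieldTheory.Balaban1983to89.B9WalkLettersCoordsS (cubeDomY)
open Literature.MathematicalPhysics.QuantumFieldTheory.Balaban1983to89.B9Thm37CubeCoverCommutators (cutMulY)
open Literature.MathematicalPhysics.QuantumFieldTheory.Balaban1983to89.B9Thm311ReadingCoords (trIP PosDefTr)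
open Literature.MathematicalPhysics.QuantumFieldTheory.Balaban1983to89.LatticeNorms (scaleLen)
open Literature.MathematicalPhysics.QuantumFieldTheory.Balaban1983to89.B5TorusCover (UT)
open Literature.MathematicalPhysics.QuantumFieldTheory.Balaban1983to89.B13EntrywiseWalks (RawEntryLetters)
open Literature.MathematicalPhysics.QuantumFieldTheory.Balaban1983to89.B9Eq39Adjoint (prodCfg)
open Literature.MathematicalPhysics.QuantumFieldTheory.Balaban1983to89.B13DirichletLocalCoerciveBall (posDefTr_padDeltaALocY_parSymY_prodCfg_one_of_sup_lt)
open Summit.QuantumFields.YangMills.BalabanUVNodes.N06Row17LocalClauseOnReg335 (posDefTr_padDeltaALocY_of_ball_of_regYP335)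
open scoped Matrix
open scoped Matrix.Norms.L2Operator

variable {N : ℕ} {d ℓ : ℕ} {hd : 1 ≤ d + 1} {hL : Odd (ℓ + 1) ∧ 1 < ℓ + 1} {b₀ b₁ : ℝ} {Mstar : ℕ}
variable {ν : ℕ} {Nf : Fin ν → ℕ} [∀ j, NeZero (Nf j)]

/-- ★★★ **ROW 17's LOCAL CLAUSE ON (3.35) AT `□̃(c)` FROM THE LOCAL-CUBE ROAD'S LETTERS** — the composition `…OfBall.posDefTr_padDeltaALocY_of_ball_of_regYP335 ∘
B13DirichletLocalCoerciveBall.posDefTr_padDeltaALocY_parSymY_prodCfg_one_of_sup_lt`: for `U` in print's class, `PosDefTr 1 (padDeltaALocY … (cubeDomY x c) … U)`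
from L5's pencil letters `hA`, fibre count `hfib`, centre coercivity `hco`, radius inequalities `hR′ hR′R hsmall`, and the (3.35) comparison `2L⁴·Mα₀·(Lʲη)⁻¹ ≤ R′`.
[cite: Balaban1985BackgroundPropagators, Thm 3.11 proof p.416, Cor. 3.6 p.408, (3.35) p.396, p.409, p.410 L14–15; Balaban1988RG2Cluster, p.15] -/
theorem posDefTr_padDeltaALocY_of_L5_of_regYP335 [Nonempty (Fin N)] {G : Subgroup (Matrix (Fin N) (Fin N) ℂ)ˣ}
    (x : MemberY d ℓ hd hL b₀ b₁ Mstar) (c : ↥(cubes x.toKIdx.D.toDomains)) (χP : BlkY x.toKIdx → ℝ) {χ : FBondY x.toKIdx → ℝ}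
    (hχD : ∀ b, χ b ≠ 0 → boxEquiv x.toKIdx.hN b.src ∈ cubeDomY x c)
    {cthr α₀ : ℝ} (hc : cthr ≤ 10) (hα : 0 ≤ α₀) {U : CfgV1 (PV d ℓ x.m x.K hd hL) (Matrix (Fin N) (Fin N) ℂ)}
    (hreg : (bg9YP (Matrix (Fin N) (Fin N) ℂ) G x).Reg335 cthr α₀ U)
    {loc : FBondY x.toKIdx × (Fin N × Fin N) → UT Nf} {R R' ρ B m : ℝ}
    (hA : RawEntryLetters (fun a : Fin (d + 1) → Site (PV d ℓ x.m x.K hd hL) 0 → Matrix (Fin N) (Fin N) ℂ =>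
      LinearMap.toMatrix
        ((Pi.basis fun _ : FBondY x.toKIdx => Matrix.stdBasis ℂ (Fin N) (Fin N)).reindex (Equiv.sigmaEquivProd (FBondY x.toKIdx) (Fin N × Fin N)))
        ((Pi.basis fun _ : FBondY x.toKIdx => Matrix.stdBasis ℂ (Fin N) (Fin N)).reindex (Equiv.sigmaEquivProd (FBondY x.toKIdx) (Fin N × Fin N)))
        (padDeltaALocY x.toKIdx (parSymY x.toKIdx) (parBY x.toKIdx) (cubeDomY x c) (cutMulY χP) (cutMulY χ)
          (prodCfg (1 : CfgY (Matrix (Fin N) (Fin N) ℂ) x.toKIdx) (kGeo x.toKIdx).eta a))) loc R ρ B)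
    (hρ : 0 < ρ) {mF : ℕ} (hfib : ∀ y : UT Nf, (univ.filter fun k => loc k = y).card ≤ mF)
    (hco : ∀ Ψ : FBondY x.toKIdx → Matrix (Fin N) (Fin N) ℂ,
      m * trIP (fun _ => (1 : ℝ)) Ψ Ψ ≤
        trIP (fun _ => (1 : ℝ)) Ψ (padDeltaALocY x.toKIdx (parSymY x.toKIdx) (parBY x.toKIdx) (cubeDomY x c) (cutMulY χP) (cutMulY χ) 1 Ψ))
    (hR' : 0 < R') (hR'R : R' ≤ R) (hsmall : 2 * (B * (mF * B6.c0 1 ρ ^ ν)) * R' < m * R)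
    (hCr : 2 * (kGeo x.toKIdx).L ^ 4 * ((kGeo x.toKIdx).M * α₀) * (scaleLen (kGeo x.toKIdx).L (kGeo x.toKIdx).eta c.1.1)⁻¹ ≤ R') :
    PosDefTr (fun _ => (1 : ℝ)) (padDeltaALocY x.toKIdx (parSymY x.toKIdx) (parBY x.toKIdx) (cubeDomY x c) (cutMulY χP) (cutMulY χ) U) :=
  posDefTr_padDeltaALocY_of_ball_of_regYP335 x c χP hχD hc hα hreg hR'
    (posDefTr_padDeltaALocY_parSymY_prodCfg_one_of_sup_lt x.toKIdx _ _ _ _ hA hρ hfib hco hR' hR'R hsmall) hCr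

end Summit.QuantumFields.YangMills.BalabanUVNodes.N06Row17LocalClauseOnReg335OfL5

end
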